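import Summits.MatrixMultiplication.OmegaCensus.DominoShiftedForm
import Mathlib.NumberTheory.Zsqrtd.GaussianInt
import HarnessLib

/-!
# Gaussian-integer characters of `ℤ₄ × ℤ₄` and the character form of the shifted domino identity

ω-census `pub-omega`, family (b3), seat pub-omega-group gen 14.  Framing: lottery ticket; floor = certified bounds/negative
ranges.  VALUE: the tool kit for `DominoPartThreeZ4Z4.lean` (no `(1,1 | 3,3 | e,e)` law triple over `A ↠ ℤ₄ × ℤ₄`); NOT
progress on ω.

Everything is written with explicit expressions (no new definitions, no notation): `I = ⟨0,1⟩ ∈ ℤ[i]`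
(`GaussianInt`), the character `q ↦ I ^ ⟨w,q⟩` of `Q = ZMod 4 × ZMod 4` with `⟨w,q⟩ = w.1 q.1 + w.2 q.2`, and its pull-back
`a ↦ I ^ (w.1 (φ a).1 + w.2 (φ a).2).val` along `φ : A →+ Q`.
* §1 bookkeeping in `ℤ[i]` by `decide`: multiplicativity, conjugation, oddness (`re + im ≡ 1 (mod 2)`), norm `1`;
  `exists_dual_pair`: coordinates `w, w'` adapted to two vectors `p, q ∈ Q` not both killed by any real character.
* §2 arithmetic of `a b + u ā b + v a b̄ = −w₀`: elimination of `b̄` (`det_mul_eq`: `(p̄p − q q̄) b = p̄ r − q r̄`), the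
  norm comparison `eq_zero_of_det_mul`, and the two `decide` tables for `a = ζ(2+i)`, `a = ζ(1+2i)` (`ζ = I^m`,
  `u = I^j`): for the 'bad' classes of `j − 2m` the determinant has norm `≥ 121` while the right side has norm `≤ 45`.
* §3 `shifted_form_charsum`: summing a multiplicative `χ : A → R` over the partition
  `(X+Y) ⊔ (β + (Y−X)) ⊔ (γ + (X−Y)) ⊔ {x₀} = A` of `domino_shifted_form_of_law` gives
  `∑_A χ = χ(X)χ(Y) + χ(β)χ(−X)χ(Y) + χ(γ)χ(X)χ(−Y) + χ(x₀)`.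
* §4 the pulled-back characters: multiplicative, conjugate under negation, orthogonality (`∑_A ψ_w = 0` for `w ≠ 0`,
  `φ` onto), oddness of odd-size sums (`re + im` odd ⇒ `≠ 0`), symmetry lemmas for the shifted form.
-/

namespace Summit.MatrixMultiplication.OmegaCensus

open Finset

/-! ## 1. Powers of `i` indexed by `ZMod 4`, and the pairing on `ZMod 4 × ZMod 4` -/

section Z4

/-- `i^(m+m') = i^m i^m'` for exponents in `ZMod 4`. [folklore] -/
theorem ipow_add (m m' : ZMod 4) :
    (⟨0, 1⟩ : GaussianInt) ^ (m + m').val = (⟨0, 1⟩ : GaussianInt) ^ m.val * (⟨0, 1⟩ : GaussianInt) ^ m'.val := by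
  revert m m'; decide

/-- `conj(i^m) = i^(−m)`. [folklore] -/
theorem star_ipow (m : ZMod 4) :
    star ((⟨0, 1⟩ : GaussianInt) ^ m.val) = (⟨0, 1⟩ : GaussianInt) ^ (-m).val := by
  revert m; decide

/-- The real characters are self-conjugate: `conj(i^(2s)) = i^(2s)`. [folklore] -/
theorem star_ipow_two_mul (s : ZMod 4) :
    star ((⟨0, 1⟩ : GaussianInt) ^ (2 * s).val) = (⟨0, 1⟩ : GaussianInt) ^ (2 * s).val := by
  revert s; decide

/-- Every value `i^m` is odd: `re + im ≡ 1 (mod 2)`. [folklore] -/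
theorem ipow_reim (m : ZMod 4) :
    ((((⟨0, 1⟩ : GaussianInt) ^ m.val).re + ((⟨0, 1⟩ : GaussianInt) ^ m.val).im : ℤ) : ZMod 2) = 1 := by
  revert m; decide

/-- `i^m` has norm `1`. [folklore] -/
theorem norm_ipow (m : ZMod 4) : ((⟨0, 1⟩ : GaussianInt) ^ m.val).norm = 1 := by revert m; decide

/-- Two values `±1` different from `1` multiply to `1`. [folklore] -/
theorem ipow_two_mul_add (s t : ZMod 4) (hs : (⟨0, 1⟩ : GaussianInt) ^ (2 * s).val ≠ 1)
    (ht : (⟨0, 1⟩ : GaussianInt) ^ (2 * t).val ≠ 1) : (⟨0, 1⟩ : GaussianInt) ^ (2 * s + 2 * t).val = 1 := by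
  revert s t; decide

/-- `2 + i` and `1 + 2i` as sums of character values. [folklore] -/
theorem gi_two_one :
    (⟨2, 1⟩ : GaussianInt) = 1 + (⟨0, 1⟩ : GaussianInt) ^ (1 : ZMod 4).val + (⟨0, 1⟩ : GaussianInt) ^ (0 : ZMod 4).val := by
  decide

/-- `1 + 2i` as a sum of character values. [folklore] -/
theorem gi_one_two :
    (⟨1, 2⟩ : GaussianInt) = 1 + (⟨0, 1⟩ : GaussianInt) ^ (1 : ZMod 4).val + (⟨0, 1⟩ : GaussianInt) ^ (1 : ZMod 4).val := by
  decide

/-- Additivity of the pairing `⟨w, q⟩ = w.1 q.1 + w.2 q.2` in `q`. [folklore] -/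
theorem z4pair_add_right (w q q' : ZMod 4 × ZMod 4) :
    w.1 * (q + q').1 + w.2 * (q + q').2 = (w.1 * q.1 + w.2 * q.2) + (w.1 * q'.1 + w.2 * q'.2) := by
  simp only [Prod.fst_add, Prod.snd_add]; ring

/-- Additivity of the pairing in `w`. [folklore] -/
theorem z4pair_add_left (w w' q : ZMod 4 × ZMod 4) :
    (w + w').1 * q.1 + (w + w').2 * q.2 = (w.1 * q.1 + w.2 * q.2) + (w'.1 * q.1 + w'.2 * q.2) := by
  simp only [Prod.fst_add, Prod.snd_add]; ring

/-- The pairing and negation. [folklore] -/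
theorem z4pair_neg_right (w q : ZMod 4 × ZMod 4) : w.1 * (-q).1 + w.2 * (-q).2 = -(w.1 * q.1 + w.2 * q.2) := by
  simp only [Prod.fst_neg, Prod.snd_neg]; ring

/-- The pairing with `w + w`. [folklore] -/
theorem z4pair_two (w q : ZMod 4 × ZMod 4) : (w + w).1 * q.1 + (w + w).2 * q.2 = 2 * (w.1 * q.1 + w.2 * q.2) := by
  rw [z4pair_add_left, two_mul]

/-- A non-zero `w ∈ Q` pairs non-trivially with some `q`. [folklore] -/
theorem exists_z4pair_ne (w : ZMod 4 × ZMod 4) (hw : w ≠ 0) :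
    ∃ q : ZMod 4 × ZMod 4, (⟨0, 1⟩ : GaussianInt) ^ (w.1 * q.1 + w.2 * q.2).val ≠ 1 := by
  revert w; decide

/-- **Coordinates.** If `p, q ∈ Q` are not both killed by any of the three real characters, there are `w, w'` pairing
with `(p, q)` to `(1, 0)` and `(0, 1)`. [folklore] -/
theorem exists_dual_pair (p q : ZMod 4 × ZMod 4)
    (h1 : ¬ ((⟨0, 1⟩ : GaussianInt) ^ (2 * p.1 + 0 * p.2).val = 1 ∧
      (⟨0, 1⟩ : GaussianInt) ^ (2 * q.1 + 0 * q.2).val = 1))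
    (h2 : ¬ ((⟨0, 1⟩ : GaussianInt) ^ (0 * p.1 + 2 * p.2).val = 1 ∧
      (⟨0, 1⟩ : GaussianInt) ^ (0 * q.1 + 2 * q.2).val = 1))
    (h3 : ¬ ((⟨0, 1⟩ : GaussianInt) ^ (2 * p.1 + 2 * p.2).val = 1 ∧
      (⟨0, 1⟩ : GaussianInt) ^ (2 * q.1 + 2 * q.2).val = 1)) :
    ∃ w w' : ZMod 4 × ZMod 4, w.1 * p.1 + w.2 * p.2 = 1 ∧ w.1 * q.1 + w.2 * q.2 = 0 ∧
      w'.1 * p.1 + w'.2 * p.2 = 0 ∧ w'.1 * q.1 + w'.2 * q.2 = 1 := by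
  revert p q; decide

end Z4

/-! ## 2. Gaussian-integer arithmetic of the equation `a b + u ā b + v a b̄ = −w₀` -/

section Gauss

/-- Eliminating `b̄`: from `p b + q b̄ = r` (and its conjugate), `(p̄ p − q q̄) b = p̄ r − q r̄`. [folklore] -/
theorem det_mul_eq (p q r b : GaussianInt) (h : p * b + q * star b = r) :
    (star p * p - q * star q) * b = star p * r - q * star r := by
  have h2 : star p * star b + star q * b = star r := by
    have := congrArg star h
    simpa only [star_add, star_mul, star_star, mul_comm] using this
  linear_combination (star p) * h - q * h2

/-- A Gaussian integer whose `re + im` is odd is non-zero. [folklore] -/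
theorem gaussInt_ne_zero_of_reim {b : GaussianInt} (hb : ((b.re + b.im : ℤ) : ZMod 2) = 1) : b ≠ 0 := by
  rintro rfl
  revert hb; decide

/-- Norm comparison: `D · b = N` with `norm D ≥ 121`, `norm N ≤ 45` forces `b = 0`. [folklore] -/
theorem eq_zero_of_det_mul {D N b : GaussianInt} (h : D * b = N) (hD : 121 ≤ D.norm) (hN : N.norm ≤ 45) : b = 0 := by
  by_contra hb
  have hb1 : 1 ≤ b.norm := by
    have h0 : 0 ≤ b.norm := Zsqrtd.norm_nonneg (by norm_num) b
    have hne : b.norm ≠ 0 := fun h' => hb ((Zsqrtd.norm_eq_zero_iff (by norm_num) b).1 h')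
    omega
  have := Zsqrtd.norm_mul D b
  rw [h] at this
  nlinarith

/-- **The `2 + i` table** (`decide`, `256` cases).  With `a = i^m (2+i)`, `u = i^j`, `v = i^k`, `w₀ = i^l`,
`p = a + u ā`, `q = v a`, `r = −w₀`: if `j − 2m ∈ {0, 1}` then `norm(p̄p − q q̄) ≥ 121` and `norm(p̄ r − q r̄) ≤ 45`.
[folklore] -/
theorem table_two_add_i : ∀ m j k l : ZMod 4, (j - 2 * m = 0 ∨ j - 2 * m = 1) →
    121 ≤ (star ((⟨0, 1⟩ : GaussianInt) ^ m.val * ⟨2, 1⟩ +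
              (⟨0, 1⟩ : GaussianInt) ^ j.val * star ((⟨0, 1⟩ : GaussianInt) ^ m.val * ⟨2, 1⟩)) *
          ((⟨0, 1⟩ : GaussianInt) ^ m.val * ⟨2, 1⟩ +
            (⟨0, 1⟩ : GaussianInt) ^ j.val * star ((⟨0, 1⟩ : GaussianInt) ^ m.val * ⟨2, 1⟩)) -
        ((⟨0, 1⟩ : GaussianInt) ^ k.val * ((⟨0, 1⟩ : GaussianInt) ^ m.val * ⟨2, 1⟩)) *
          star ((⟨0, 1⟩ : GaussianInt) ^ k.val * ((⟨0, 1⟩ : GaussianInt) ^ m.val * ⟨2, 1⟩))).norm ∧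
      (star ((⟨0, 1⟩ : GaussianInt) ^ m.val * ⟨2, 1⟩ +
            (⟨0, 1⟩ : GaussianInt) ^ j.val * star ((⟨0, 1⟩ : GaussianInt) ^ m.val * ⟨2, 1⟩)) *
          (-(⟨0, 1⟩ : GaussianInt) ^ l.val) -
        ((⟨0, 1⟩ : GaussianInt) ^ k.val * ((⟨0, 1⟩ : GaussianInt) ^ m.val * ⟨2, 1⟩)) *
          star (-(⟨0, 1⟩ : GaussianInt) ^ l.val)).norm ≤ 45 := by
  decide

/-- **The `1 + 2i` table** (`decide`): with `a = i^m (1+2i)`, if `j − 2m ∈ {1, 2}` then `norm(p̄p − q q̄) ≥ 121` and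
`norm(p̄ r − q r̄) ≤ 45`. [folklore] -/
theorem table_one_add_two_i : ∀ m j k l : ZMod 4, (j - 2 * m = 1 ∨ j - 2 * m = 2) →
    121 ≤ (star ((⟨0, 1⟩ : GaussianInt) ^ m.val * ⟨1, 2⟩ +
              (⟨0, 1⟩ : GaussianInt) ^ j.val * star ((⟨0, 1⟩ : GaussianInt) ^ m.val * ⟨1, 2⟩)) *
          ((⟨0, 1⟩ : GaussianInt) ^ m.val * ⟨1, 2⟩ +
            (⟨0, 1⟩ : GaussianInt) ^ j.val * star ((⟨0, 1⟩ : GaussianInt) ^ m.val * ⟨1, 2⟩)) -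
        ((⟨0, 1⟩ : GaussianInt) ^ k.val * ((⟨0, 1⟩ : GaussianInt) ^ m.val * ⟨1, 2⟩)) *
          star ((⟨0, 1⟩ : GaussianInt) ^ k.val * ((⟨0, 1⟩ : GaussianInt) ^ m.val * ⟨1, 2⟩))).norm ∧
      (star ((⟨0, 1⟩ : GaussianInt) ^ m.val * ⟨1, 2⟩ +
            (⟨0, 1⟩ : GaussianInt) ^ j.val * star ((⟨0, 1⟩ : GaussianInt) ^ m.val * ⟨1, 2⟩)) *
          (-(⟨0, 1⟩ : GaussianInt) ^ l.val) -
        ((⟨0, 1⟩ : GaussianInt) ^ k.val * ((⟨0, 1⟩ : GaussianInt) ^ m.val * ⟨1, 2⟩)) *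
          star (-(⟨0, 1⟩ : GaussianInt) ^ l.val)).norm ≤ 45 := by
  decide

/-- **Combination of the three exclusions** (`decide`): `j − 2m, j' − 2m' ∉ {0,1}` and
`(j+j') − 2(m+m') ∉ {1,2}` force `2j = 2j' = 0`. [folklore] -/
theorem two_mul_eq_zero_of_exclusions : ∀ m j m' j' : ZMod 4,
    ¬ (j - 2 * m = 0 ∨ j - 2 * m = 1) → ¬ (j' - 2 * m' = 0 ∨ j' - 2 * m' = 1) →
    ¬ ((j + j') - 2 * (m + m') = 1 ∨ (j + j') - 2 * (m + m') = 2) → 2 * j = 0 ∧ 2 * j' = 0 := by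
  decide

end Gauss

/-! ## 3. The character-sum identity of the shifted domino form -/

section CharSum

variable {A : Type*} [AddCommGroup A] [Fintype A] [DecidableEq A]

/-- **Character form of the shifted near-factorisation.**  For a multiplicative `χ : A → R` and the data of
`domino_shifted_form_of_law` — `(X+Y) ⊔ (β + (Y−X)) ⊔ (γ + (X−Y)) = A ∖ {x₀}`, `X + Y` direct —
`∑_A χ = χ(X)χ(Y) + χ(β) χ(−X) χ(Y) + χ(γ) χ(X) χ(−Y) + χ(x₀)`. [folklore] -/
theorem shifted_form_charsum {R : Type*} [CommRing R] (χ : A → R) (hmul : ∀ a b, χ (a + b) = χ a * χ b)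
    {X Y : Finset A} {β γ x₀ : A}
    (hinj : Set.InjOn (fun p : A × A => p.1 + p.2) ↑(X ×ˢ Y))
    (hPQ : Disjoint ((X ×ˢ Y).image fun p : A × A => p.1 + p.2)
      (((Y ×ˢ X).image fun p : A × A => p.1 - p.2).image fun z => z + β))
    (hPR : Disjoint ((X ×ˢ Y).image fun p : A × A => p.1 + p.2)
      (((X ×ˢ Y).image fun p : A × A => p.1 - p.2).image fun z => z + γ))
    (hQR : Disjoint (((Y ×ˢ X).image fun p : A × A => p.1 - p.2).image fun z => z + β)
      (((X ×ˢ Y).image fun p : A × A => p.1 - p.2).image fun z => z + γ))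
    (hcover : ((X ×ˢ Y).image fun p : A × A => p.1 + p.2) ∪
      (((Y ×ˢ X).image fun p : A × A => p.1 - p.2).image fun z => z + β) ∪
      (((X ×ˢ Y).image fun p : A × A => p.1 - p.2).image fun z => z + γ) = univ.erase x₀) :
    ∑ a, χ a = (∑ x ∈ X, χ x) * (∑ y ∈ Y, χ y) + χ β * (∑ x ∈ X, χ (-x)) * (∑ y ∈ Y, χ y) +
      χ γ * (∑ x ∈ X, χ x) * (∑ y ∈ Y, χ (-y)) + χ x₀ := by
  have hsplit : ∑ a, χ a = (∑ a ∈ univ.erase x₀, χ a) + χ x₀ :=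
    (sum_erase_add _ _ (mem_univ x₀)).symm
  rw [hsplit, ← hcover, sum_union (disjoint_union_left.2 ⟨hPR, hQR⟩), sum_union hPQ]
  have hP : ∑ a ∈ (X ×ˢ Y).image (fun p : A × A => p.1 + p.2), χ a = (∑ x ∈ X, χ x) * (∑ y ∈ Y, χ y) := by
    rw [sum_image hinj, sum_product, sum_mul_sum]
    exact sum_congr rfl fun x _ => sum_congr rfl fun y _ => hmul x y
  have hQ : ∑ a ∈ ((Y ×ˢ X).image fun p : A × A => p.1 - p.2).image (fun z => z + β), χ a =
      χ β * (∑ x ∈ X, χ (-x)) * (∑ y ∈ Y, χ y) := by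
    rw [sum_image fun z _ z' _ h => add_right_cancel h, sum_image (injOn_diff_of_injOn_sum hinj), sum_product,
      mul_assoc, mul_comm (∑ x ∈ X, χ (-x)), sum_mul_sum, mul_sum]
    refine sum_congr rfl fun y _ => ?_
    rw [mul_sum]
    refine sum_congr rfl fun x _ => ?_
    rw [show y - x + β = β + (y + -x) by abel, hmul, hmul]
  have hR : ∑ a ∈ ((X ×ˢ Y).image fun p : A × A => p.1 - p.2).image (fun z => z + γ), χ a =
      χ γ * (∑ x ∈ X, χ x) * (∑ y ∈ Y, χ (-y)) := by
    rw [sum_image fun z _ z' _ h => add_right_cancel h, sum_image (injOn_diff_of_injOn_sum' hinj), sum_product,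
      mul_assoc, sum_mul_sum, mul_sum]
    refine sum_congr rfl fun x _ => ?_
    rw [mul_sum]
    refine sum_congr rfl fun y _ => ?_
    rw [show x - y + γ = γ + (x + -y) by abel, hmul, hmul]
  rw [hP, hQ, hR]

omit [Fintype A] in
/-- The sumset does not depend on the order of the factors. [folklore] -/
theorem image_add_swap (X Y : Finset A) :
    ((Y ×ˢ X).image fun p : A × A => p.1 + p.2) = (X ×ˢ Y).image fun p : A × A => p.1 + p.2 := by
  ext a
  simp only [mem_image, mem_product, Prod.exists]
  constructor
  · rintro ⟨y, x, ⟨hy, hx⟩, rfl⟩; exact ⟨x, y, ⟨hx, hy⟩, add_comm x y⟩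
  · rintro ⟨x, y, ⟨hx, hy⟩, rfl⟩; exact ⟨y, x, ⟨hy, hx⟩, add_comm y x⟩

omit [Fintype A] [DecidableEq A] in
/-- Directness does not depend on the order of the factors. [folklore] -/
theorem injOn_add_swap {X Y : Finset A} (hinj : Set.InjOn (fun p : A × A => p.1 + p.2) ↑(X ×ˢ Y)) :
    Set.InjOn (fun p : A × A => p.1 + p.2) ↑(Y ×ˢ X) := by
  rintro ⟨y, x⟩ h ⟨y', x'⟩ h' he
  simp only [coe_product, Set.mem_prod, mem_coe] at h h'
  change y + x = y' + x' at he
  have hm : (x, y) ∈ (↑(X ×ˢ Y) : Set (A × A)) := by simp [h.1, h.2]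
  have hm' : (x', y') ∈ (↑(X ×ˢ Y) : Set (A × A)) := by simp [h'.1, h'.2]
  have := hinj hm hm' (by change x + y = x' + y'; rw [add_comm, he, add_comm])
  simp only [Prod.mk.injEq] at this
  rw [this.1, this.2]

/-- In the shifted form both `|X|` and `|Y|` are odd as soon as `|A|` is even (`3|X||Y| = |A| − 1`). [folklore] -/
theorem odd_cards_of_shifted_form (heven : Even (Fintype.card A)) {X Y : Finset A} {β γ x₀ : A}
    (hinj : Set.InjOn (fun p : A × A => p.1 + p.2) ↑(X ×ˢ Y))
    (hPQ : Disjoint ((X ×ˢ Y).image fun p : A × A => p.1 + p.2)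
      (((Y ×ˢ X).image fun p : A × A => p.1 - p.2).image fun z => z + β))
    (hPR : Disjoint ((X ×ˢ Y).image fun p : A × A => p.1 + p.2)
      (((X ×ˢ Y).image fun p : A × A => p.1 - p.2).image fun z => z + γ))
    (hQR : Disjoint (((Y ×ˢ X).image fun p : A × A => p.1 - p.2).image fun z => z + β)
      (((X ×ˢ Y).image fun p : A × A => p.1 - p.2).image fun z => z + γ))
    (hcover : ((X ×ˢ Y).image fun p : A × A => p.1 + p.2) ∪
      (((Y ×ˢ X).image fun p : A × A => p.1 - p.2).image fun z => z + β) ∪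
      (((X ×ˢ Y).image fun p : A × A => p.1 - p.2).image fun z => z + γ) = univ.erase x₀) :
    Odd X.card ∧ Odd Y.card := by
  have hcard := congrArg Finset.card hcover
  rw [card_union_of_disjoint (disjoint_union_left.2 ⟨hPR, hQR⟩), card_union_of_disjoint hPQ,
    card_image_of_injective _ (add_left_injective β), card_image_of_injective _ (add_left_injective γ),
    card_sumset₂ hinj, card_diffset₂ hinj, card_image_of_injOn (injOn_diff_of_injOn_sum' hinj), card_product,
    card_erase_of_mem (mem_univ x₀), card_univ] at hcard
  obtain ⟨k, hk⟩ := heven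
  have hpos : 0 < Fintype.card A := Fintype.card_pos
  have hodd : Odd (X.card * Y.card) := by
    rw [Nat.odd_iff]; omega
  exact Nat.odd_mul.1 hodd

end CharSum

/-! ## 4. The pulled-back characters `a ↦ i^⟨w, φ a⟩` -/

section Pullback

variable {A : Type*} [AddCommGroup A] [Fintype A]

omit [Fintype A] in
/-- `ψ_w` is multiplicative. [folklore] -/
theorem z4char_add (φ : A →+ ZMod 4 × ZMod 4) (w : ZMod 4 × ZMod 4) (a b : A) :
    (⟨0, 1⟩ : GaussianInt) ^ (w.1 * (φ (a + b)).1 + w.2 * (φ (a + b)).2).val =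
      (⟨0, 1⟩ : GaussianInt) ^ (w.1 * (φ a).1 + w.2 * (φ a).2).val *
        (⟨0, 1⟩ : GaussianInt) ^ (w.1 * (φ b).1 + w.2 * (φ b).2).val := by
  rw [map_add, z4pair_add_right, ipow_add]

omit [Fintype A] in
/-- `ψ_w(−a) = conj ψ_w(a)`. [folklore] -/
theorem z4char_neg (φ : A →+ ZMod 4 × ZMod 4) (w : ZMod 4 × ZMod 4) (a : A) :
    (⟨0, 1⟩ : GaussianInt) ^ (w.1 * (φ (-a)).1 + w.2 * (φ (-a)).2).val =
      star ((⟨0, 1⟩ : GaussianInt) ^ (w.1 * (φ a).1 + w.2 * (φ a).2).val) := by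
  rw [map_neg, z4pair_neg_right, star_ipow]

/-- **Orthogonality.** For `φ` onto and `w ≠ 0`, `∑_A ψ_w = 0`. [folklore] -/
theorem z4char_sum_eq_zero (φ : A →+ ZMod 4 × ZMod 4) (hφ : Function.Surjective φ) (w : ZMod 4 × ZMod 4)
    (hw : w ≠ 0) : ∑ a, (⟨0, 1⟩ : GaussianInt) ^ (w.1 * (φ a).1 + w.2 * (φ a).2).val = 0 := by
  obtain ⟨q, hq⟩ := exists_z4pair_ne w hw
  obtain ⟨c, rfl⟩ := hφ q
  have h1 : ∑ a, (⟨0, 1⟩ : GaussianInt) ^ (w.1 * (φ a).1 + w.2 * (φ a).2).val =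
      ∑ a, (⟨0, 1⟩ : GaussianInt) ^ (w.1 * (φ (a + c)).1 + w.2 * (φ (a + c)).2).val :=
    (Fintype.sum_equiv (Equiv.addRight c) _ _ fun _ => rfl).symm
  simp only [z4char_add, ← sum_mul] at h1
  have h2 : (∑ a, (⟨0, 1⟩ : GaussianInt) ^ (w.1 * (φ a).1 + w.2 * (φ a).2).val) *
      (1 - (⟨0, 1⟩ : GaussianInt) ^ (w.1 * (φ c).1 + w.2 * (φ c).2).val) = 0 := by
    rw [mul_sub, mul_one, ← h1, sub_self]
  have h3 := congrArg Zsqrtd.norm h2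
  rw [Zsqrtd.norm_mul, Zsqrtd.norm_zero] at h3
  rcases mul_eq_zero.1 h3 with h | h
  · exact (Zsqrtd.norm_eq_zero_iff (by norm_num) _).1 h
  · exfalso; apply hq
    have := (Zsqrtd.norm_eq_zero_iff (by norm_num) _).1 h
    exact (sub_eq_zero.1 this).symm

omit [Fintype A] in
/-- Odd-size character sums are odd, hence non-zero. [folklore] -/
theorem z4char_sum_ne_zero (φ : A →+ ZMod 4 × ZMod 4) (w : ZMod 4 × ZMod 4) {Y : Finset A} (hY : Odd Y.card) :
    ∑ y ∈ Y, (⟨0, 1⟩ : GaussianInt) ^ (w.1 * (φ y).1 + w.2 * (φ y).2).val ≠ 0 := by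
  apply gaussInt_ne_zero_of_reim
  let π : GaussianInt →+ ZMod 2 :=
    { toFun := fun z => ((z.re + z.im : ℤ) : ZMod 2)
      map_zero' := by simp
      map_add' := fun z z' => by simp only [Zsqrtd.re_add, Zsqrtd.im_add]; push_cast; ring }
  have hπ : ∀ z : GaussianInt, ((z.re + z.im : ℤ) : ZMod 2) = π z := fun _ => rfl
  rw [hπ, map_sum]
  have : ∀ y ∈ Y, π ((⟨0, 1⟩ : GaussianInt) ^ (w.1 * (φ y).1 + w.2 * (φ y).2).val) = 1 := fun y _ => by
    rw [← hπ]; exact ipow_reim _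
  rw [sum_congr rfl this, sum_const, nsmul_eq_mul, mul_one]
  obtain ⟨k, hk⟩ := hY
  rw [hk]; push_cast
  have : (2 : ZMod 2) = 0 := by decide
  rw [this, zero_mul, zero_add]

/-- A group mapping onto `ZMod 4 × ZMod 4` has even order. [folklore] -/
theorem even_card_of_onto_z4z4 (φ : A →+ ZMod 4 × ZMod 4) (hφ : Function.Surjective φ) :
    Even (Fintype.card A) := by
  have h16 : Fintype.card (ZMod 4 × ZMod 4) ∣ Fintype.card A := by
    rw [← Nat.card_eq_fintype_card, ← Nat.card_eq_fintype_card]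
    exact AddSubgroup.card_dvd_of_surjective φ hφ
  have : Fintype.card (ZMod 4 × ZMod 4) = 16 := by simp
  rw [this] at h16
  obtain ⟨k, hk⟩ := h16
  exact ⟨8 * k, by omega⟩

end Pullback

end Summit.MatrixMultiplication.OmegaCensus
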